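import Mathlib.Topology.Algebra.Module.FiniteDimension
import Mathlib.Topology.Instances.Matrix
import Mathlib.Analysis.Complex.Basic
import Literature.Barriers.QuantumFields.NoClassicalGlueballsTraceForm
import HarnessLib

/-!
# N15 (NE2): TRACE-FORM-ORTHONORMAL COORDINATES ON `M_m(ℂ)` — THE WITNESS OF THE STANDING HYPOTHESIS `he`

dag-n15-a g31, KNIT-BY-NAME seat, node N15 = NE2. HONEST LABEL: a NON-VACUITY witness (linear algebra, no physics); count-neutral; N15 stays
DISCHARGED OF RECORD 8∕28 AS CONSUMED on p687738; no count.

WHAT.  Seventy-five N15 files (dag-n15-a∕-b∕-c: Σ-A … Σ-Q, FILE 15 … 193b) carry the standing hypothesis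

  `he : ∀ A B : Matrix mm mm ℂ, traceForm A B = e A ⬝ᵥ e B`   for some `e : Matrix mm mm ℂ ≃L[ℝ] (ι → ℝ)`,

i.e. real coordinates on `M_m(ℂ)` in which the real trace form `Re tr(AᴴB)` (`Literature.Barriers.QuantumFields.traceForm`) is the dot product.
This file CONSTRUCTS such coordinates once and for all — the real and imaginary parts of the entries, indexed by `Fin 2 × mm × mm` —
and proves `he` for them:

* `tfCoordsₗ mm : Matrix mm mm ℂ ≃ₗ[ℝ] (Fin 2 × mm × mm → ℝ)` (`A ↦ ((0,i,j) ↦ Re A_{ij}, (1,i,j) ↦ Im A_{ij})`), `tfCoords mm` its continuous version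
  (finite dimension), `tfCoords_apply`;
* ★ `traceForm_eq_tfCoords_dotProduct : traceForm A B = tfCoords mm A ⬝ᵥ tfCoords mm B` — the hypothesis `he` DISCHARGED for `e := tfCoords mm`,
  `ι := Fin 2 × mm × mm` (nonempty as soon as `mm` is).

So every `he`-hypothesised N15 literal has an UNCONDITIONAL instance (e.g. (Q-7) §4 `live_and_n15At_sfObjects₅qv_tf`).

References: folklore (`Re tr(AᴴB) = Σ_{ij} (Re A_{ij} Re B_{ij} + Im A_{ij} Im B_{ij})`, `traceForm_eq_sum`).
-/

namespace Summit.QuantumFields.YangMills.BalabanUVNodes.N15.TraceFormCoords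

open Literature.Barriers.QuantumFields (traceForm traceForm_eq_sum)
open scoped Matrix

variable (mm : Type) [Fintype mm]

/-- The real∕imaginary-part coordinates of a complex matrix, as a real-linear equivalence `M_m(ℂ) ≃ (Fin 2 × m × m → ℝ)`. [folklore] -/
def tfCoordsₗ : Matrix mm mm ℂ ≃ₗ[ℝ] (Fin 2 × mm × mm → ℝ) where
  toFun A := fun p => if p.1 = 0 then (A p.2.1 p.2.2).re else (A p.2.1 p.2.2).im
  invFun f := fun i j => ((f (0, i, j) : ℝ) : ℂ) + ((f (1, i, j) : ℝ) : ℂ) * Complex.I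
  map_add' A B := by
    funext p
    by_cases h : p.1 = 0 <;> simp [h, Matrix.add_apply]
  map_smul' c A := by
    funext p
    by_cases h : p.1 = 0 <;> simp [h, Matrix.smul_apply]
  left_inv A := by
    funext i j
    apply Complex.ext <;> simp
  right_inv f := by
    funext p
    obtain ⟨k, i, j⟩ := p
    fin_cases k <;> simp

omit [Fintype mm] in
/-- Entry formula of the coordinates. [folklore] -/
theorem tfCoordsₗ_apply (A : Matrix mm mm ℂ) (p : Fin 2 × mm × mm) :
    tfCoordsₗ mm A p = if p.1 = 0 then (A p.2.1 p.2.2).re else (A p.2.1 p.2.2).im := rfl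

/-- ★ The real∕imaginary-part coordinates as a CONTINUOUS real-linear equivalence `M_m(ℂ) ≃L[ℝ] (Fin 2 × m × m → ℝ)` (finite dimension). [folklore] -/
noncomputable def tfCoords : Matrix mm mm ℂ ≃L[ℝ] (Fin 2 × mm × mm → ℝ) :=
  haveI : FiniteDimensional ℝ (Matrix mm mm ℂ) := inferInstanceAs (FiniteDimensional ℝ (mm → mm → ℂ))
  (tfCoordsₗ mm).toContinuousLinearEquiv

/-- Entry formula of the continuous coordinates. [folklore] -/
theorem tfCoords_apply (A : Matrix mm mm ℂ) (p : Fin 2 × mm × mm) :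
    tfCoords mm A p = if p.1 = 0 then (A p.2.1 p.2.2).re else (A p.2.1 p.2.2).im := rfl

/-- ★ **THE TRACE FORM IS THE DOT PRODUCT OF THE COORDINATES**: `Re tr(AᴴB) = tfCoords A ⬝ᵥ tfCoords B` — the standing hypothesis `he` of the N15 literals DISCHARGED for
`e := tfCoords mm`. [folklore] -/
theorem traceForm_eq_tfCoords_dotProduct (A B : Matrix mm mm ℂ) : traceForm A B = tfCoords mm A ⬝ᵥ tfCoords mm B := by
  rw [traceForm_eq_sum, dotProduct, Fintype.sum_prod_type, Fin.sum_univ_two]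
  simp only [tfCoords_apply, Fintype.sum_prod_type, if_true, Fin.one_eq_zero_iff, OfNat.ofNat_ne_one, if_false]
  rw [← Finset.sum_add_distrib]
  refine Finset.sum_congr rfl fun i _ => ?_
  rw [← Finset.sum_add_distrib]

/-- The packaged witness: real coordinates in which the trace form is the dot product EXIST (index type `Fin 2 × mm × mm`). [folklore] -/
theorem exists_traceForm_coords :
    ∃ e : Matrix mm mm ℂ ≃L[ℝ] (Fin 2 × mm × mm → ℝ), ∀ A B : Matrix mm mm ℂ, traceForm A B = e A ⬝ᵥ e B :=
  ⟨tfCoords mm, traceForm_eq_tfCoords_dotProduct mm⟩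

end Summit.QuantumFields.YangMills.BalabanUVNodes.N15.TraceFormCoords
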